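import Summits.ResolutionOfSingularities.ResolutionOfSingularities.Theorems.FrobeniusLadderFInjectiveMacaulayficationPencilPairPrimality
import Summits.ResolutionOfSingularities.ResolutionOfSingularities.Theorems.FrobeniusLadderFInjectiveMacaulayficationPencilIntegral
import Summits.ResolutionOfSingularities.ResolutionOfSingularities.Theorems.FrobeniusLadderFInjectiveMacaulayficationPencilPhiPrime
import Mathlib.LinearAlgebra.Matrix.Notation
import Mathlib.Algebra.MvPolynomial.NoZeroDivisors
import Mathlib.Algebra.Polynomial.SpecificDegree
import HarnessLib

/-!
# BED Ω, GLOBAL PATCH (g-b), F4 (c) GLUE — PER-CHART INSTANCES of the pencil-pair algebra on the PENCIL CHARTS of `X̃ = Bl_L(X_{B9})`, families A and B (charts 0, 6, 12, 18 ∣ 4, 10, 16, 22):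
# `Prime θ_c`, `(θ_c, χ_c)` prime, `u ∉ (θ_c, χ_c)`, `θ_c ∤ χ_c`, `θ_c ∤ u` — the hypotheses `hg`/`hgu` of ✓ `PencilQuotFinSucc.cmCl_localization_pencilQuot` and `hP`/`hu` of
# ✓ `PencilQuotFinSucc.regularPair_of_isPrime` feeding ✓p709719 `PencilBlowupLocalCharts.cmCl_stalk_of_pair`
# (crux `FInjectiveMacaulayfication` stmt-ResolutionOfSingularities-15315, chain w45a; res-L1-w45a-plan-1 DEDUP RULING R24.11 (iii) «per-chart INSTANCES = stub-1ʼs file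
# `…PencilChartPairInstances`, importing stub-3ʼs generic kit ✓ `PencilPairPrimality`, in stub-3ʼs Fin-index convention; family B ∪ A first, C after»; seat res-L1-w45a-stub-1 g16;
# consumer res-L1-w45a-stub-3 g14)

[OURS · L1 W4.5a] Support file (`--supports stmt-ResolutionOfSingularities-15315 --as helper`); theorems only (polynomial algebra over an arbitrary field `k`); no definition, no named fact;
NOT a statement of any manuscript; nothing of the crux is proved and no census row is asserted. AI-written (AI review is weaker than expert review).

THE DATA (✓ `B9NewtonKTables`: bed `f = z² + x⁹ + y⁹ + u⁹ + t⁹`, `(x,y,u,t,z) = (X 0,…,X 4)`; 25 unimodular cone charts `CL`; class-centre chart vertices `MV2`; Ω₁ʼs marked ideal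
`𝒥 = (L + (g))·𝒪_{X̃}`, `g = x·u² − y³`). On the cone chart `c` with ray rows `V` and coordinates `y₀..y₄` (`x^m ↦ y^{V m}`), `f ↦ y^{·}·θ_c` (strict transform) and
`𝒥 ↦ (y^{V m_c}, y^{VP} − y^{VQ}) = y^{G}·(y^{M₁}, χ_c)` (`P = (1,0,2,0,0)`, `Q = (0,3,0,0,0)`; always `M₂ = 0` here). The TWELVE PENCIL CHARTS (those where `y^{M₁}` is not a unit on
`X̃ ∩ U_c`) are `{0,4,5,6,10,11,12,16,17,18,22,23}`; the other 13 charts are principal (`θ_c ≡ 1` modulo the `M₁`-variables). Three `θ`-shapes (the `S₄`-symmetry of `f` in `x,y,u,t`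
makes `θ_c` literally one polynomial per family; only `χ_c` varies):
* family A `{0,6,12,18}` (rays `e·,e·,e·,ρ₈,ρ₁₀`): `θ_A = 1 + y₃·(1 + y₀⁹ + y₁⁹ + y₂⁹)`, `u = y₃²⁰y₄⁴³` (`y₃` is a unit on `X̃ ∩ U_c`);
* family B `{4,10,16,22}` (rays `e·,e·,e·,ρ₉,ρ₁₀`): `θ_B = y₃ + 1 + y₀⁹ + y₁⁹ + y₂⁹`, `u = y₃²²y₄⁴³`;
* family C `{5,11,17,23}` (rays `e_z,e·,e·,e·,ρ₉`): `θ_C = y₀²y₄ + 1 + y₁⁹ + y₂⁹ + y₃⁹`, `u = y₄²²` — in the companion file `…PencilChartPairInstancesC`;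
`χ_c = y₁² − y₂³ (c = 0, 4)`, `y₁²y₂ − 1 (6, 10)`, `y₂ − y₁³ (12, 16)`, `y₀²y₂ − y₁³ (18, 22)`.
LETTERS (res-L1-w45a-stub-3ʼs «linear variable first» convention of ✓p707995/✓p708243, pencil variable dropped): `X 0 = y₃`, `X 1 = y₀`, `X 2 = y₁`, `X 3 = y₂`, `X 4 = y₄`; so
`θ_A = (C 1 + X 1⁹ + X 2⁹ + X 3⁹)·X 0 + C 1`, `θ_B = X 0 + C 1 + X 1⁹ + X 2⁹ + X 3⁹` (the `Fin 5` twins of ✓ `prime_theta18` / `prime_theta22`), `u = X 0^a·X 4^b`, and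
`χ = X 2² − X 3³ ∣ X 2²·X 3 − 1 ∣ X 3 − X 2³ ∣ X 1²·X 3 − X 2³` on charts `0,4 ∣ 6,10 ∣ 12,16 ∣ 18,22`. BASE LETTERS (the four non-linear variables, renamed along `Fin.succ` by
✓ `PencilIntegral.pencilChart_isPrime`): `X 0..X 3 = y₀, y₁, y₂, y₄`.
* §1 generic shapes: `prime_cusp` (`X 0² − X 1³`, any number `≥ 2` of variables), the `X 0`-linear primes `X 1²·X 0 − 1`, `X 0 − X 1³`, `X 1²·X 0 − X 2³`, the four `χ`ʼs in `k[X 0..X 3]`,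
  `Prime θ_A`, `Prime θ_B` in `k[X 0..X 4]`;
* §2 ★ the eight pair primalities `isPrime_span_thetaB_chi4/10/16/22`, `isPrime_span_thetaA_chi0/6/12/18`;
* §3 witnesses at rational points where the generators vanish and the candidate is `±1` (every characteristic): `X 0^a·X 4^b ∉ (θ, χ)`, `θ ∤ χ`, `θ ∤ X 0^a·X 4^b`.
[folklore; cite: Matsumura1987, Thm. 17.4; CoxLittleSchenck2011, §2.3 (toric charts)]
-/

set_option linter.dupNamespace false

noncomputable section

open MvPolynomial

namespace Summit.ResolutionOfSingularities.ResolutionOfSingularities.Theorems.FInjectiveMacaulayfication.PencilChartPairInstances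

open Summit.ResolutionOfSingularities.ResolutionOfSingularities.Theorems.FInjectiveMacaulayfication
open PencilPairPrimality

variable (k : Type) [Field k]

/-! ## §1 Generic shapes -/

/-- `X 0³` is not a square in `k[X 0, …, X m]` (odd total degree). [elementary] -/
theorem sq_ne_X_pow_three {m : ℕ} (q : MvPolynomial (Fin (m + 1)) k) : q ^ 2 ≠ (X 0) ^ 3 := by
  intro h
  have hq : q ≠ 0 := by
    intro hq
    rw [hq, zero_pow two_ne_zero] at h
    exact (pow_ne_zero 3 (X_ne_zero (0 : Fin (m + 1)))) h.symm
  have hdeg := congrArg totalDegree h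
  rw [pow_two, totalDegree_mul_of_isDomain hq hq, totalDegree_X_pow] at hdeg
  omega

/-- **THE CUSP `X 0² − X 1³` IS PRIME** in `k[X 0, …, X_{m+1}]` (monic quadratic in `X 0` over `k[X 1, …]` without a root). [folklore; the proof of ✓ `OmegaOneFloorInput.prime_B` in any
number of variables] -/
theorem prime_cusp (m : ℕ) : Prime (X 0 ^ 2 - X 1 ^ 3 : MvPolynomial (Fin (m + 2)) k) := by
  have hfs : finSuccEquiv k (m + 1) (X 0 ^ 2 - X 1 ^ 3 : MvPolynomial (Fin (m + 2)) k) = Polynomial.X ^ 2 - Polynomial.C ((X 0 : MvPolynomial (Fin (m + 1)) k) ^ 3) := by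
    have h1 : finSuccEquiv k (m + 1) (X 1 : MvPolynomial (Fin (m + 2)) k) = Polynomial.C (X 0) := by
      rw [show (1 : Fin (m + 2)) = (0 : Fin (m + 1)).succ from Fin.succ_zero_eq_one.symm, finSuccEquiv_X_succ]
    rw [map_sub, map_pow, map_pow, finSuccEquiv_X_zero, h1, ← map_pow]
  have hmonic : (Polynomial.X ^ 2 - Polynomial.C ((X 0 : MvPolynomial (Fin (m + 1)) k) ^ 3)).Monic := Polynomial.monic_X_pow_sub_C _ two_ne_zero
  have hdeg : (Polynomial.X ^ 2 - Polynomial.C ((X 0 : MvPolynomial (Fin (m + 1)) k) ^ 3)).natDegree = 2 := Polynomial.natDegree_X_pow_sub_C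
  have hirr : Irreducible (Polynomial.X ^ 2 - Polynomial.C ((X 0 : MvPolynomial (Fin (m + 1)) k) ^ 3)) := by
    rw [hmonic.irreducible_iff_roots_eq_zero_of_degree_le_three (by omega) (by omega), Multiset.eq_zero_iff_forall_notMem]
    intro a ha
    rw [Polynomial.mem_roots hmonic.ne_zero, Polynomial.IsRoot, Polynomial.eval_sub, Polynomial.eval_pow, Polynomial.eval_X, Polynomial.eval_C, sub_eq_zero] at ha
    exact sq_ne_X_pow_three k a ha
  rw [← hfs] at hirr
  exact ((MulEquiv.irreducible_iff (finSuccEquiv k (m + 1)).toMulEquiv).mp hirr).prime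

/-- `Prime (X 1²·X 0 − 1)` in `k[X 0, …, X_{m+1}]` (linear in `X 0`). [folklore; ✓ `PencilPhiPrime.prime_pencilPhiAffine`] -/
theorem prime_sq_mul_sub_one (m : ℕ) : Prime (X 1 ^ 2 * X 0 - 1 : MvPolynomial (Fin (m + 2)) k) := by
  have h := PencilPhiPrime.prime_pencilPhiAffine k ((X 0 : MvPolynomial (Fin (m + 1)) k) ^ 2) 1 (pow_ne_zero 2 (X_ne_zero _))
    (fun t ht => by rwa [one_mul] at ht)
  rwa [map_pow, rename_X, map_one, Fin.succ_zero_eq_one] at h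

/-- `Prime (X 0 − X 1³)` in `k[X 0, …, X_{m+1}]`. [folklore; ✓ `prime_pencilPhiAffine`] -/
theorem prime_X_sub_cube (m : ℕ) : Prime (X 0 - X 1 ^ 3 : MvPolynomial (Fin (m + 2)) k) := by
  have h := PencilPhiPrime.prime_pencilPhiAffine k (1 : MvPolynomial (Fin (m + 1)) k) ((X 0 : MvPolynomial (Fin (m + 1)) k) ^ 3) one_ne_zero
    (fun t _ => by rw [Ideal.span_singleton_one]; exact Submodule.mem_top)
  rwa [map_one, one_mul, map_pow, rename_X, Fin.succ_zero_eq_one] at h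

/-- `Prime (X 1²·X 0 − X 2³)` in `k[X 0, …, X_{m+2}]` (`X 1³` is regular modulo `X 0²` in the base ring). [folklore; ✓ `prime_pencilPhiAffine`] -/
theorem prime_sq_mul_sub_cube (m : ℕ) : Prime (X 1 ^ 2 * X 0 - X 2 ^ 3 : MvPolynomial (Fin (m + 3)) k) := by
  have hX : ¬ (X 0 : MvPolynomial (Fin (m + 2)) k) ∣ X 1 ^ 3 := fun h => by
    have h01 := (X_dvd_X (R := k) (σ := Fin (m + 2))).1 ((X_prime (i := (0 : Fin (m + 2)))).dvd_of_dvd_pow h)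
    exact absurd h01 (by simp)
  have h := PencilPhiPrime.prime_pencilPhiAffine k ((X 0 : MvPolynomial (Fin (m + 2)) k) ^ 2) ((X 1 : MvPolynomial (Fin (m + 2)) k) ^ 3) (pow_ne_zero 2 (X_ne_zero _))
    (fun t ht => by
      rw [Ideal.mem_span_singleton] at ht ⊢
      exact (X_prime (i := (0 : Fin (m + 2)))).pow_dvd_of_dvd_mul_left 2 hX ht)
  rwa [map_pow, rename_X, map_pow, rename_X, Fin.succ_zero_eq_one, Fin.succ_one_eq_two] at h

/-- **`χ₄ = χ₀ = X 1² − X 2³` is prime** in `k[X 0..X 3]`. [folklore] -/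
theorem prime_chi4 : Prime (X 1 ^ 2 - X 2 ^ 3 : MvPolynomial (Fin 4) k) := by
  have h := prime_rename_equiv k ((Equiv.swap (0 : Fin 4) 1).trans (Equiv.swap (0 : Fin 4) 2)) (prime_cusp k 2)
  have e0 : ((Equiv.swap (0 : Fin 4) 1).trans (Equiv.swap (0 : Fin 4) 2)) 0 = 1 := by decide
  have e1 : ((Equiv.swap (0 : Fin 4) 1).trans (Equiv.swap (0 : Fin 4) 2)) 1 = 2 := by decide
  rw [map_sub, map_pow, map_pow, rename_X, rename_X, e0, e1] at h
  exact h

/-- **`χ₁₀ = χ₆ = X 1²·X 2 − 1` is prime** in `k[X 0..X 3]`. [folklore] -/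
theorem prime_chi10 : Prime (X 1 ^ 2 * X 2 - 1 : MvPolynomial (Fin 4) k) := by
  have h := prime_rename_equiv k (Equiv.swap (0 : Fin 4) 2) (prime_sq_mul_sub_one k 2)
  have e0 : Equiv.swap (0 : Fin 4) 2 0 = 2 := by decide
  have e1 : Equiv.swap (0 : Fin 4) 2 1 = 1 := by decide
  rw [map_sub, map_mul, map_pow, rename_X, rename_X, e0, e1, map_one] at h
  exact h

/-- **`χ₁₆ = χ₁₂ = X 2 − X 1³` is prime** in `k[X 0..X 3]`. [folklore] -/
theorem prime_chi16 : Prime (X 2 - X 1 ^ 3 : MvPolynomial (Fin 4) k) := by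
  have h := prime_rename_equiv k (Equiv.swap (0 : Fin 4) 2) (prime_X_sub_cube k 2)
  have e0 : Equiv.swap (0 : Fin 4) 2 0 = 2 := by decide
  have e1 : Equiv.swap (0 : Fin 4) 2 1 = 1 := by decide
  rw [map_sub, map_pow, rename_X, rename_X, e0, e1] at h
  exact h

/-- **`χ₂₂ = χ₁₈ = X 0²·X 2 − X 1³` is prime** in `k[X 0..X 3]`. [folklore] -/
theorem prime_chi22 : Prime (X 0 ^ 2 * X 2 - X 1 ^ 3 : MvPolynomial (Fin 4) k) := by
  have h := prime_rename_equiv k ((Equiv.swap (0 : Fin 4) 1).trans (Equiv.swap (1 : Fin 4) 2)) (prime_sq_mul_sub_cube k 1)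
  have e0 : ((Equiv.swap (0 : Fin 4) 1).trans (Equiv.swap (1 : Fin 4) 2)) 0 = 2 := by decide
  have e1 : ((Equiv.swap (0 : Fin 4) 1).trans (Equiv.swap (1 : Fin 4) 2)) 1 = 0 := by decide
  have e2 : ((Equiv.swap (0 : Fin 4) 1).trans (Equiv.swap (1 : Fin 4) 2)) 2 = 1 := by decide
  rw [map_sub, map_mul, map_pow, map_pow, rename_X, rename_X, rename_X, e0, e1, e2] at h
  exact h

/-- **`θ_B = X 0 + C 1 + X 1⁹ + X 2⁹ + X 3⁹` IS PRIME** in `k[X 0..X 4]` (the `Fin 5` twin of ✓ `OmegaOneActualChart22CM.prime_theta22`). [elementary] -/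
theorem prime_thetaB : Prime (X 0 + C 1 + X 1 ^ 9 + X 2 ^ 9 + X 3 ^ 9 : MvPolynomial (Fin 5) k) := by
  have h := PencilPhiPrime.prime_pencilPhiAffine k (1 : MvPolynomial (Fin 4) k) (-(C 1 + X 0 ^ 9 + X 1 ^ 9 + X 2 ^ 9)) one_ne_zero
    (fun t _ => by rw [Ideal.span_singleton_one]; exact Submodule.mem_top)
  have he : (rename Fin.succ (1 : MvPolynomial (Fin 4) k) * X 0 - rename Fin.succ (-(C 1 + X 0 ^ 9 + X 1 ^ 9 + X 2 ^ 9) : MvPolynomial (Fin 4) k) : MvPolynomial (Fin 5) k) =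
      X 0 + C 1 + X 1 ^ 9 + X 2 ^ 9 + X 3 ^ 9 := by
    simp only [map_one, map_neg, map_add, map_pow, rename_X]
    have h1 : (Fin.succ (0 : Fin 4) : Fin 5) = 1 := rfl
    have h2 : (Fin.succ (1 : Fin 4) : Fin 5) = 2 := rfl
    have h3 : (Fin.succ (2 : Fin 4) : Fin 5) = 3 := rfl
    rw [h1, h2, h3]; ring
  rwa [he] at h

/-- `C 1 + X 0⁹ + X 1⁹ + X 2⁹ ≠ 0` in `k[X 0..X 3]` (it is `1` at the origin). [elementary] -/
theorem sumA_ne_zero : (C 1 + X 0 ^ 9 + X 1 ^ 9 + X 2 ^ 9 : MvPolynomial (Fin 4) k) ≠ 0 := by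
  intro h
  have h0 := congrArg (eval (0 : Fin 4 → k)) h
  simp at h0

/-- **`θ_A = (C 1 + X 1⁹ + X 2⁹ + X 3⁹)·X 0 + C 1` IS PRIME** in `k[X 0..X 4]` (the `Fin 5` twin of ✓ `OmegaOneActualChartsCM.prime_theta18`). [elementary] -/
theorem prime_thetaA : Prime ((C 1 + X 1 ^ 9 + X 2 ^ 9 + X 3 ^ 9) * X 0 + C 1 : MvPolynomial (Fin 5) k) := by
  have h := PencilPhiPrime.prime_pencilPhiAffine k (C 1 + X 0 ^ 9 + X 1 ^ 9 + X 2 ^ 9 : MvPolynomial (Fin 4) k) (-C 1) (sumA_ne_zero k)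
    (fun t ht => by rwa [neg_mul, Ideal.neg_mem_iff, C_1, one_mul] at ht)
  have he : (rename Fin.succ (C 1 + X 0 ^ 9 + X 1 ^ 9 + X 2 ^ 9 : MvPolynomial (Fin 4) k) * X 0 - rename Fin.succ (-C 1 : MvPolynomial (Fin 4) k) : MvPolynomial (Fin 5) k) =
      (C 1 + X 1 ^ 9 + X 2 ^ 9 + X 3 ^ 9) * X 0 + C 1 := by
    simp only [map_neg, map_add, map_pow, rename_X, rename_C]
    have h1 : (Fin.succ (0 : Fin 4) : Fin 5) = 1 := rfl
    have h2 : (Fin.succ (1 : Fin 4) : Fin 5) = 2 := rfl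
    have h3 : (Fin.succ (2 : Fin 4) : Fin 5) = 3 := rfl
    rw [h1, h2, h3]; ring
  rwa [he] at h

/-! ## §2 The pair ideals `(θ, χ)` are prime — families B and A -/

/-- The four `χ`ʼs renamed along `Fin.succ`: `k[X 0..X 3] → k[X 0..X 4]`. [bookkeeping] -/
theorem rename_succ_chis :
    (rename Fin.succ (X 1 ^ 2 - X 2 ^ 3 : MvPolynomial (Fin 4) k) : MvPolynomial (Fin 5) k) = X 2 ^ 2 - X 3 ^ 3 ∧
    (rename Fin.succ (X 1 ^ 2 * X 2 - 1 : MvPolynomial (Fin 4) k) : MvPolynomial (Fin 5) k) = X 2 ^ 2 * X 3 - 1 ∧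
    (rename Fin.succ (X 2 - X 1 ^ 3 : MvPolynomial (Fin 4) k) : MvPolynomial (Fin 5) k) = X 3 - X 2 ^ 3 ∧
    (rename Fin.succ (X 0 ^ 2 * X 2 - X 1 ^ 3 : MvPolynomial (Fin 4) k) : MvPolynomial (Fin 5) k) = X 1 ^ 2 * X 3 - X 2 ^ 3 := by
  have h0 : (Fin.succ (0 : Fin 4) : Fin 5) = 1 := rfl
  have h1 : (Fin.succ (1 : Fin 4) : Fin 5) = 2 := rfl
  have h2 : (Fin.succ (2 : Fin 4) : Fin 5) = 3 := rfl
  refine ⟨?_, ?_, ?_, ?_⟩ <;> simp only [map_sub, map_mul, map_pow, map_one, rename_X, h0, h1, h2]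

/-- The family-B pencil generator from ✓ `pencilChart_isPrime`ʼs letters: `1⁺·X 0 − (−(C 1 + X 0⁹ + X 1⁹ + X 2⁹))⁺ = θ_B`. [bookkeeping] -/
theorem pencil_thetaB :
    (rename Fin.succ (1 : MvPolynomial (Fin 4) k) * X 0 - rename Fin.succ (-(C 1 + X 0 ^ 9 + X 1 ^ 9 + X 2 ^ 9) : MvPolynomial (Fin 4) k) : MvPolynomial (Fin 5) k) =
      X 0 + C 1 + X 1 ^ 9 + X 2 ^ 9 + X 3 ^ 9 := by
  have h0 : (Fin.succ (0 : Fin 4) : Fin 5) = 1 := rfl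
  have h1 : (Fin.succ (1 : Fin 4) : Fin 5) = 2 := rfl
  have h2 : (Fin.succ (2 : Fin 4) : Fin 5) = 3 := rfl
  simp only [map_one, map_neg, map_add, map_pow, rename_X, h0, h1, h2]
  ring

/-- The family-A pencil generator: `(C 1 + X 0⁹ + X 1⁹ + X 2⁹)⁺·X 0 − (−C 1)⁺ = θ_A`. [bookkeeping] -/
theorem pencil_thetaA :
    (rename Fin.succ (C 1 + X 0 ^ 9 + X 1 ^ 9 + X 2 ^ 9 : MvPolynomial (Fin 4) k) * X 0 - rename Fin.succ (-C 1 : MvPolynomial (Fin 4) k) : MvPolynomial (Fin 5) k) =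
      (C 1 + X 1 ^ 9 + X 2 ^ 9 + X 3 ^ 9) * X 0 + C 1 := by
  have h0 : (Fin.succ (0 : Fin 4) : Fin 5) = 1 := rfl
  have h1 : (Fin.succ (1 : Fin 4) : Fin 5) = 2 := rfl
  have h2 : (Fin.succ (2 : Fin 4) : Fin 5) = 3 := rfl
  simp only [map_neg, map_add, map_pow, rename_X, rename_C, h0, h1, h2]
  ring

/-- Family B: `(θ_B, χ⁺)` is prime for every prime `χ ∈ k[X 0..X 3]` (`k[X 0..X 4]/(θ_B, χ⁺) ≅ k[X 0..X 3]/(χ)`, eliminating the linear variable). [folklore; ✓ `pencilChart_isPrime`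
with `M = 1`] -/
theorem isPrime_span_thetaB_of_prime (χ : MvPolynomial (Fin 4) k) (hχ : Prime χ) :
    (Ideal.span {X 0 + C 1 + X 1 ^ 9 + X 2 ^ 9 + X 3 ^ 9, rename Fin.succ χ} : Ideal (MvPolynomial (Fin 5) k)).IsPrime := by
  have h := PencilIntegral.pencilChart_isPrime k χ 1 (-(C 1 + X 0 ^ 9 + X 1 ^ 9 + X 2 ^ 9)) hχ (fun h1 => hχ.not_unit (isUnit_of_dvd_one h1))
    (fun t _ => by
      have htop : Ideal.span ({χ, 1} : Set (MvPolynomial (Fin 4) k)) = ⊤ := Ideal.eq_top_of_isUnit_mem _ (Ideal.subset_span (by simp)) isUnit_one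
      rw [htop]; exact Submodule.mem_top)
  rwa [pencil_thetaB, Set.pair_comm] at h

/-- Family A: `(θ_A, χ⁺)` is prime for every prime `χ ∈ k[X 0..X 3]` not dividing `C 1 + X 0⁹ + X 1⁹ + X 2⁹` (`k[X 0..X 4]/(θ_A, χ⁺) ≅ (k[X 0..X 3]/(χ))[1/(1 + Σ)]`). [folklore;
✓ `pencilChart_isPrime` with `B = −1`] -/
theorem isPrime_span_thetaA_of_prime (χ : MvPolynomial (Fin 4) k) (hχ : Prime χ) (hχM : ¬ χ ∣ C 1 + X 0 ^ 9 + X 1 ^ 9 + X 2 ^ 9) :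
    (Ideal.span {(C 1 + X 1 ^ 9 + X 2 ^ 9 + X 3 ^ 9) * X 0 + C 1, rename Fin.succ χ} : Ideal (MvPolynomial (Fin 5) k)).IsPrime := by
  have h := PencilIntegral.pencilChart_isPrime k χ (C 1 + X 0 ^ 9 + X 1 ^ 9 + X 2 ^ 9) (-C 1) hχ hχM
    (fun t ht => by rwa [neg_mul, Ideal.neg_mem_iff, C_1, one_mul] at ht)
  rwa [pencil_thetaA, Set.pair_comm] at h

/-- ★ **CHART 4**: `(θ_B, X 2² − X 3³)` is a prime ideal of `k[X 0..X 4]`. [OURS · F4 (c) input `hP`] -/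
theorem isPrime_span_thetaB_chi4 : (Ideal.span {X 0 + C 1 + X 1 ^ 9 + X 2 ^ 9 + X 3 ^ 9, X 2 ^ 2 - X 3 ^ 3} : Ideal (MvPolynomial (Fin 5) k)).IsPrime := by
  rw [← (rename_succ_chis k).1]; exact isPrime_span_thetaB_of_prime k _ (prime_chi4 k)

/-- ★ **CHART 10**: `(θ_B, X 2²·X 3 − 1)` is prime. [OURS · F4 (c) input `hP`] -/
theorem isPrime_span_thetaB_chi10 : (Ideal.span {X 0 + C 1 + X 1 ^ 9 + X 2 ^ 9 + X 3 ^ 9, X 2 ^ 2 * X 3 - 1} : Ideal (MvPolynomial (Fin 5) k)).IsPrime := by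
  rw [← (rename_succ_chis k).2.1]; exact isPrime_span_thetaB_of_prime k _ (prime_chi10 k)

/-- ★ **CHART 16**: `(θ_B, X 3 − X 2³)` is prime. [OURS · F4 (c) input `hP`] -/
theorem isPrime_span_thetaB_chi16 : (Ideal.span {X 0 + C 1 + X 1 ^ 9 + X 2 ^ 9 + X 3 ^ 9, X 3 - X 2 ^ 3} : Ideal (MvPolynomial (Fin 5) k)).IsPrime := by
  rw [← (rename_succ_chis k).2.2.1]; exact isPrime_span_thetaB_of_prime k _ (prime_chi16 k)

/-- ★ **CHART 22**: `(θ_B, X 1²·X 3 − X 2³)` is prime. [OURS · F4 (c) input `hP`] -/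
theorem isPrime_span_thetaB_chi22 : (Ideal.span {X 0 + C 1 + X 1 ^ 9 + X 2 ^ 9 + X 3 ^ 9, X 1 ^ 2 * X 3 - X 2 ^ 3} : Ideal (MvPolynomial (Fin 5) k)).IsPrime := by
  rw [← (rename_succ_chis k).2.2.2]; exact isPrime_span_thetaB_of_prime k _ (prime_chi22 k)

/-- ★ **CHART 0**: `(θ_A, X 2² − X 3³)` is prime (`χ ∤ 1 + Σ`: at the origin `χ = 0`, `1 + Σ = 1`). [OURS · F4 (c) input `hP`] -/
theorem isPrime_span_thetaA_chi0 : (Ideal.span {(C 1 + X 1 ^ 9 + X 2 ^ 9 + X 3 ^ 9) * X 0 + C 1, X 2 ^ 2 - X 3 ^ 3} : Ideal (MvPolynomial (Fin 5) k)).IsPrime := by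
  rw [← (rename_succ_chis k).1]
  exact isPrime_span_thetaA_of_prime k _ (prime_chi4 k) (not_dvd_of_eval k (0 : Fin 4 → k) (by simp) (by simp))

/-- ★ **CHART 6**: `(θ_A, X 2²·X 3 − 1)` is prime (`χ ∤ 1 + Σ`: at `(0, −1, 1, 0)` `χ = 0`, `1 + Σ = 1`). [OURS · F4 (c) input `hP`] -/
theorem isPrime_span_thetaA_chi6 : (Ideal.span {(C 1 + X 1 ^ 9 + X 2 ^ 9 + X 3 ^ 9) * X 0 + C 1, X 2 ^ 2 * X 3 - 1} : Ideal (MvPolynomial (Fin 5) k)).IsPrime := by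
  rw [← (rename_succ_chis k).2.1]
  exact isPrime_span_thetaA_of_prime k _ (prime_chi10 k) (not_dvd_of_eval k (![0, -1, 1, 0] : Fin 4 → k) (by simp [eval_X]) (by simp [eval_X, show (-1 : k) ^ 9 = -1 by norm_num]))

/-- ★ **CHART 12**: `(θ_A, X 3 − X 2³)` is prime. [OURS · F4 (c) input `hP`] -/
theorem isPrime_span_thetaA_chi12 : (Ideal.span {(C 1 + X 1 ^ 9 + X 2 ^ 9 + X 3 ^ 9) * X 0 + C 1, X 3 - X 2 ^ 3} : Ideal (MvPolynomial (Fin 5) k)).IsPrime := by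
  rw [← (rename_succ_chis k).2.2.1]
  exact isPrime_span_thetaA_of_prime k _ (prime_chi16 k) (not_dvd_of_eval k (0 : Fin 4 → k) (by simp) (by simp))

/-- ★ **CHART 18**: `(θ_A, X 1²·X 3 − X 2³)` is prime. [OURS · F4 (c) input `hP`] -/
theorem isPrime_span_thetaA_chi18 : (Ideal.span {(C 1 + X 1 ^ 9 + X 2 ^ 9 + X 3 ^ 9) * X 0 + C 1, X 1 ^ 2 * X 3 - X 2 ^ 3} : Ideal (MvPolynomial (Fin 5) k)).IsPrime := by
  rw [← (rename_succ_chis k).2.2.2]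
  exact isPrime_span_thetaA_of_prime k _ (prime_chi22 k) (not_dvd_of_eval k (0 : Fin 4 → k) (by simp) (by simp))

/-! ## §3 Witnesses: `u ∉ (θ, χ)`, `θ ∤ χ`, `θ ∤ u` (rational points; values `±1`, every characteristic) -/

/-- At a point with `X 0 = −1`, `X 4 = 1` every monomial `X 0^a·X 4^b` takes the value `(−1)^a ≠ 0`. [elementary] -/
theorem eval_monomial04_ne_zero (pt : Fin 5 → k) (h0 : pt 0 = -1) (h4 : pt 4 = 1) (a b : ℕ) : eval pt (X 0 ^ a * X 4 ^ b : MvPolynomial (Fin 5) k) ≠ 0 := by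
  rw [map_mul, map_pow, map_pow, eval_X, eval_X, h0, h4, one_pow, mul_one]
  exact pow_ne_zero _ (neg_ne_zero.mpr one_ne_zero)

/-- ★ **CHART 4**: no monomial `X 0^a·X 4^b` (`= y₃^a y₄^b`, in particular `u = y₃²²y₄⁴³`) lies in `(θ_B, χ₄)` (point `(−1, 0, 0, 0, 1)`). [OURS · F4 (c) input `hu`] -/
theorem monomial_not_mem_span_thetaB_chi4 (a b : ℕ) :
    (X 0 ^ a * X 4 ^ b : MvPolynomial (Fin 5) k) ∉ Ideal.span {X 0 + C 1 + X 1 ^ 9 + X 2 ^ 9 + X 3 ^ 9, X 2 ^ 2 - X 3 ^ 3} :=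
  not_mem_span_pair_of_eval k (![-1, 0, 0, 0, 1] : Fin 5 → k) (by simp [eval_X]) (by simp [eval_X]) (eval_monomial04_ne_zero k _ (by simp) (by simp) a b)

/-- ★ **CHART 10**: no `X 0^a·X 4^b` lies in `(θ_B, χ₁₀)` (point `(−1, 0, −1, 1, 1)`). [OURS · F4 (c) input `hu`] -/
theorem monomial_not_mem_span_thetaB_chi10 (a b : ℕ) :
    (X 0 ^ a * X 4 ^ b : MvPolynomial (Fin 5) k) ∉ Ideal.span {X 0 + C 1 + X 1 ^ 9 + X 2 ^ 9 + X 3 ^ 9, X 2 ^ 2 * X 3 - 1} :=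
  not_mem_span_pair_of_eval k (![-1, 0, -1, 1, 1] : Fin 5 → k) (by simp [eval_X, show (-1 : k) ^ 9 = -1 by norm_num]) (by simp [eval_X]) (eval_monomial04_ne_zero k _ (by simp) (by simp) a b)

/-- ★ **CHART 16**: no `X 0^a·X 4^b` lies in `(θ_B, χ₁₆)` (point `(−1, 0, 0, 0, 1)`). [OURS · F4 (c) input `hu`] -/
theorem monomial_not_mem_span_thetaB_chi16 (a b : ℕ) :
    (X 0 ^ a * X 4 ^ b : MvPolynomial (Fin 5) k) ∉ Ideal.span {X 0 + C 1 + X 1 ^ 9 + X 2 ^ 9 + X 3 ^ 9, X 3 - X 2 ^ 3} :=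
  not_mem_span_pair_of_eval k (![-1, 0, 0, 0, 1] : Fin 5 → k) (by simp [eval_X]) (by simp [eval_X]) (eval_monomial04_ne_zero k _ (by simp) (by simp) a b)

/-- ★ **CHART 22**: no `X 0^a·X 4^b` lies in `(θ_B, χ₂₂)` (point `(−1, 0, 0, 0, 1)`). [OURS · F4 (c) input `hu`] -/
theorem monomial_not_mem_span_thetaB_chi22 (a b : ℕ) :
    (X 0 ^ a * X 4 ^ b : MvPolynomial (Fin 5) k) ∉ Ideal.span {X 0 + C 1 + X 1 ^ 9 + X 2 ^ 9 + X 3 ^ 9, X 1 ^ 2 * X 3 - X 2 ^ 3} :=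
  not_mem_span_pair_of_eval k (![-1, 0, 0, 0, 1] : Fin 5 → k) (by simp [eval_X]) (by simp [eval_X]) (eval_monomial04_ne_zero k _ (by simp) (by simp) a b)

/-- ★ **CHART 0**: no `X 0^a·X 4^b` lies in `(θ_A, χ₀)` (point `(−1, 0, 0, 0, 1)`). [OURS · F4 (c) input `hu`] -/
theorem monomial_not_mem_span_thetaA_chi0 (a b : ℕ) :
    (X 0 ^ a * X 4 ^ b : MvPolynomial (Fin 5) k) ∉ Ideal.span {(C 1 + X 1 ^ 9 + X 2 ^ 9 + X 3 ^ 9) * X 0 + C 1, X 2 ^ 2 - X 3 ^ 3} :=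
  not_mem_span_pair_of_eval k (![-1, 0, 0, 0, 1] : Fin 5 → k) (by simp [eval_X]) (by simp [eval_X]) (eval_monomial04_ne_zero k _ (by simp) (by simp) a b)

/-- ★ **CHART 6**: no `X 0^a·X 4^b` lies in `(θ_A, χ₆)` (point `(−1, 0, −1, 1, 1)`). [OURS · F4 (c) input `hu`] -/
theorem monomial_not_mem_span_thetaA_chi6 (a b : ℕ) :
    (X 0 ^ a * X 4 ^ b : MvPolynomial (Fin 5) k) ∉ Ideal.span {(C 1 + X 1 ^ 9 + X 2 ^ 9 + X 3 ^ 9) * X 0 + C 1, X 2 ^ 2 * X 3 - 1} :=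
  not_mem_span_pair_of_eval k (![-1, 0, -1, 1, 1] : Fin 5 → k) (by simp [eval_X, show (-1 : k) ^ 9 = -1 by norm_num]) (by simp [eval_X]) (eval_monomial04_ne_zero k _ (by simp) (by simp) a b)

/-- ★ **CHART 12**: no `X 0^a·X 4^b` lies in `(θ_A, χ₁₂)` (point `(−1, 0, 0, 0, 1)`). [OURS · F4 (c) input `hu`] -/
theorem monomial_not_mem_span_thetaA_chi12 (a b : ℕ) :
    (X 0 ^ a * X 4 ^ b : MvPolynomial (Fin 5) k) ∉ Ideal.span {(C 1 + X 1 ^ 9 + X 2 ^ 9 + X 3 ^ 9) * X 0 + C 1, X 3 - X 2 ^ 3} :=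
  not_mem_span_pair_of_eval k (![-1, 0, 0, 0, 1] : Fin 5 → k) (by simp [eval_X]) (by simp [eval_X]) (eval_monomial04_ne_zero k _ (by simp) (by simp) a b)

/-- ★ **CHART 18**: no `X 0^a·X 4^b` lies in `(θ_A, χ₁₈)` (point `(−1, 0, 0, 0, 1)`). [OURS · F4 (c) input `hu`] -/
theorem monomial_not_mem_span_thetaA_chi18 (a b : ℕ) :
    (X 0 ^ a * X 4 ^ b : MvPolynomial (Fin 5) k) ∉ Ideal.span {(C 1 + X 1 ^ 9 + X 2 ^ 9 + X 3 ^ 9) * X 0 + C 1, X 1 ^ 2 * X 3 - X 2 ^ 3} :=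
  not_mem_span_pair_of_eval k (![-1, 0, 0, 0, 1] : Fin 5 → k) (by simp [eval_X]) (by simp [eval_X]) (eval_monomial04_ne_zero k _ (by simp) (by simp) a b)

/-- ★ **`θ_B ∤ χ` on charts 4, 10, 16, 22** (points `(−1,−1,1,0,0)` / `(−1,0,0,0,0)`, where `θ_B = 0` and `χ = ±1`). [OURS · F4 (c) input `hgu` of the `U`-chart] -/
theorem thetaB_not_dvd_chi :
    ¬ (X 0 + C 1 + X 1 ^ 9 + X 2 ^ 9 + X 3 ^ 9 : MvPolynomial (Fin 5) k) ∣ X 2 ^ 2 - X 3 ^ 3 ∧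
    ¬ (X 0 + C 1 + X 1 ^ 9 + X 2 ^ 9 + X 3 ^ 9 : MvPolynomial (Fin 5) k) ∣ X 2 ^ 2 * X 3 - 1 ∧
    ¬ (X 0 + C 1 + X 1 ^ 9 + X 2 ^ 9 + X 3 ^ 9 : MvPolynomial (Fin 5) k) ∣ X 3 - X 2 ^ 3 ∧
    ¬ (X 0 + C 1 + X 1 ^ 9 + X 2 ^ 9 + X 3 ^ 9 : MvPolynomial (Fin 5) k) ∣ X 1 ^ 2 * X 3 - X 2 ^ 3 :=
  ⟨not_dvd_of_eval k (![-1, -1, 1, 0, 0] : Fin 5 → k) (by simp [eval_X, show (-1 : k) ^ 9 = -1 by norm_num]) (by simp [eval_X]),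
   not_dvd_of_eval k (![-1, 0, 0, 0, 0] : Fin 5 → k) (by simp [eval_X]) (by simp [eval_X]),
   not_dvd_of_eval k (![-1, -1, 1, 0, 0] : Fin 5 → k) (by simp [eval_X, show (-1 : k) ^ 9 = -1 by norm_num]) (by simp [eval_X]),
   not_dvd_of_eval k (![-1, -1, 1, 0, 0] : Fin 5 → k) (by simp [eval_X, show (-1 : k) ^ 9 = -1 by norm_num]) (by simp [eval_X])⟩

/-- ★ **`θ_A ∤ χ` on charts 0, 6, 12, 18** (same points). [OURS · F4 (c) input `hgu` of the `U`-chart] -/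
theorem thetaA_not_dvd_chi :
    ¬ ((C 1 + X 1 ^ 9 + X 2 ^ 9 + X 3 ^ 9) * X 0 + C 1 : MvPolynomial (Fin 5) k) ∣ X 2 ^ 2 - X 3 ^ 3 ∧
    ¬ ((C 1 + X 1 ^ 9 + X 2 ^ 9 + X 3 ^ 9) * X 0 + C 1 : MvPolynomial (Fin 5) k) ∣ X 2 ^ 2 * X 3 - 1 ∧
    ¬ ((C 1 + X 1 ^ 9 + X 2 ^ 9 + X 3 ^ 9) * X 0 + C 1 : MvPolynomial (Fin 5) k) ∣ X 3 - X 2 ^ 3 ∧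
    ¬ ((C 1 + X 1 ^ 9 + X 2 ^ 9 + X 3 ^ 9) * X 0 + C 1 : MvPolynomial (Fin 5) k) ∣ X 1 ^ 2 * X 3 - X 2 ^ 3 :=
  ⟨not_dvd_of_eval k (![-1, -1, 1, 0, 0] : Fin 5 → k) (by simp [eval_X, show (-1 : k) ^ 9 = -1 by norm_num]) (by simp [eval_X]),
   not_dvd_of_eval k (![-1, 0, 0, 0, 0] : Fin 5 → k) (by simp [eval_X]) (by simp [eval_X]),
   not_dvd_of_eval k (![-1, -1, 1, 0, 0] : Fin 5 → k) (by simp [eval_X, show (-1 : k) ^ 9 = -1 by norm_num]) (by simp [eval_X]),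
   not_dvd_of_eval k (![-1, -1, 1, 0, 0] : Fin 5 → k) (by simp [eval_X, show (-1 : k) ^ 9 = -1 by norm_num]) (by simp [eval_X])⟩

/-- ★ **`θ_B ∤ X 0^a·X 4^b` and `θ_A ∤ X 0^a·X 4^b`** (point `(−1, 0, 0, 0, 1)`): with `Prime θ` these monomials are non-zero-divisors of `k[X]/(θ)`. [OURS · F4 (c) inputs `hγ`/`hu`] -/
theorem theta_not_dvd_monomial (a b : ℕ) :
    ¬ (X 0 + C 1 + X 1 ^ 9 + X 2 ^ 9 + X 3 ^ 9 : MvPolynomial (Fin 5) k) ∣ X 0 ^ a * X 4 ^ b ∧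
    ¬ ((C 1 + X 1 ^ 9 + X 2 ^ 9 + X 3 ^ 9) * X 0 + C 1 : MvPolynomial (Fin 5) k) ∣ X 0 ^ a * X 4 ^ b :=
  ⟨not_dvd_of_eval k (![-1, 0, 0, 0, 1] : Fin 5 → k) (by simp [eval_X]) (eval_monomial04_ne_zero k _ (by simp) (by simp) a b),
   not_dvd_of_eval k (![-1, 0, 0, 0, 1] : Fin 5 → k) (by simp [eval_X]) (eval_monomial04_ne_zero k _ (by simp) (by simp) a b)⟩

end Summit.ResolutionOfSingularities.ResolutionOfSingularities.Theorems.FInjectiveMacaulayfication.PencilChartPairInstances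

end
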